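import Literature.MathematicalPhysics.QuantumLattice.IsingAnisotropicAntiferromagnetLocalization
import HarnessLib

/-!
# Long-range order of the Ising-anisotropic quantum antiferromagnet at low temperature and small
# anisotropy (Fröhlich–Lieb 1978, model (3): §III.B Prop. 3.4 + §IV (c), (c'))

Topic `MathematicalPhysics/QuantumLattice`. Fröhlich–Lieb's main result for their model (3), the
spin-`S` quantum antiferromagnet `S⁻²Σ_{⟨ij⟩}[SᶻSᶻ + α(SˣSˣ + SʸSʸ)]` on `ℤ²` ("For each `S` there
is an `α(S)` and `β_c(α)` such that for `α < α(S)` and `β > β_c(α)` there is LRO. As `S → ∞`,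
`α(S) → 1`", §I.A (3)), assembled END TO END in the tree's typed version of their method: the
volume-uniform Peierls–chessboard chain `PeierlsChessboardTorusXYZ` (Thm. 1.1, Cor. 1.2, (1.44))
for the rotated real form `H(α) = xyzRealFieldHamiltonian L n α (-α) 0 = -Σ(αS¹S¹ - αS²S² + S³S³)`
(FL (1.4a); `S = n/2`; tree units are `S²`·FL's), fed with the quantum smallness datum of
`IsingAnisotropicAntiferromagnetLocalization` (§III.B, Prop. 3.4, exponential localization) for the
universal dipole projection of the chain (`exists_dipolePattern_eq_diagonal`, one broken bond per
cube of side `b`):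

* `anisoAFKappa n b α t Δ β = σ̄^{(n²/4 - tΔb²)/(4n)} + (n+1)^{b²}e^{-βΔb²}`,
  `σ̄ = α(n + tΔ)/((t-1)Δ)` — the per-cube smallness constant (`R₋^{1/N²} + R₊^{1/N²}`, (4.5),
  (1.51); `t > 1` is FL's `n`, `Δ` their energy window per site, `b` the cube side);
* **`anisoAF_dipole_le`** — `Re⟨P_Λ⟩_β ≤ κ^{N²}` on `(ℤ/Nbℤ)²` for every shift and every dipole
  (FL (4.5) + (1.51) for model (3), with honest constants: Anderson's bound replaced by the
  Casimir bound, the dense universal projection of Fig. 1 by one dipole per cube);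
* **`anisoAF_twoPoint_le`**, **`anisoAF_sigma_twoPoint_ge_half`** — hence, for `N > 1` even,
  `Nb > 2`, `0 ≤ α`, `β ≥ 0`, `t > 1`, `Δ > 0` with `tΔb² ≤ n²/4`, `σ̄ < 1`, `κ ≤ 1`:
  `Re⟨Pₘ⁺Pₙ⁻⟩_β ≤ 4ρ/(1-ρ)²` (`ρ = 4·19⁶κ^{(b-1)/b⁵} < 1`) and `Re⟨σₘσₙ⟩_β ≥ 1/2` once
  `κ^{(b-1)/b⁵} ≤ 10⁻¹⁰` (`σ = P⁺ - P⁻ = sgn S³`, `P± = 𝟙[S³ ≥ 0], 𝟙[S³ < 0]`), all `m ≠ n`,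
  uniformly in the volume — long-range order (1.9) in the rotated frame, i.e. Néel order of
  `sgn Sᶻ` for the antiferromagnet;
* `anisoAF_sigma_twoPoint_ge_half_two` (cubes of side `2`: the threshold is `κ ≤ 10⁻³²⁰`),
  **`anisoAF_sigma_twoPoint_ge_half_explicit`** — for EVERY spin `n/2 ≥ 1/2`:
  `0 ≤ α ≤ (n/(64+2n))·(2·10³²⁰)^{-32/n}` and `β ≥ 16(log(2·10³²⁰) + 4log(n+1))/n²` give
  `Re⟨σₘσₙ⟩_β ≥ 1/2` on `(ℤ/2Nℤ)²` (FL's `α(S) > 0`, honest constants), and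
  **`anisoAF_longRangeOrder_of_lt_one`** — FL's "`α(S) → 1` as `S → ∞`": for every `0 ≤ α < 1`
  there is `n₀` such that every spin `n/2`, `n ≥ n₀`, has a `β₀` with `Re⟨σₘσₙ⟩_β ≥ 1/2` for all
  `β ≥ β₀`, all even `N > 1`, all `m ≠ n`.

WHAT THIS IS NOT: a statement for all `α < 1` at fixed `S` (FL: "We do not know if there is LRO for
all `α < 1` when `S` is finite. This is an open problem."); the constants are far from FL's
(`κ^{1/32}`-loss of the torus contour count, `S(S+1)` instead of Anderson). No named facts; no
sorries.

## References

* J. Fröhlich, E. H. Lieb, *Phase transitions in anisotropic lattice spin systems*, Comm. Math.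
  Phys. **60** (1978) 233–267, §I.A (3), §I.B (1.9)–(1.24), Thm. 1.1, Cor. 1.2, §III.B Prop. 3.4,
  §IV.A (4.5), §IV.B (1.51), Lemmas 4.1–4.2, §IV (c'). [FrohlichLieb1978]
* J. E. Björnberg, D. Ueltschi, *Reflection positivity and infrared bounds for quantum spin
  systems* (2022), Lemma 5.2, eq. (5.15). [BjornbergUeltschi2022]
-/

noncomputable section

open Matrix Finset
open scoped ComplexOrder MatrixOrder BigOperators
open Literature.MathematicalPhysics.QuantumLattice Literature.Probability.LatticeModels
  Literature.Barriers.CriticalPhenomena.NonGibbs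

namespace Literature.MathematicalPhysics.QuantumLattice

/-! ### The smallness constant -/

/-- **The per-cube Peierls smallness constant of the quantum antiferromagnet** (FL (4.5) + (1.51)
for model (3), tree units, cubes of side `b`, spin `n/2`, anisotropy `α`, FL's auxiliary `t > 1`
(their `n`) and energy window `Δ` per site):
`κ = σ̄^{(n²/4 - tΔb²)/(4n)} + (n+1)^{b²}·e^{-βΔb²}`, `σ̄ = α(n + tΔ)/((t-1)Δ)` — the first term is
`R₋^{1/N²}` (`σ^{2d}`, `d ≥ N²(n²/4 - tΔb²)/(8n)` steps), the second `R₊^{1/N²}`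
(`tr 1 · e^{-βΔ|Λ|}/Z`). [cite: FrohlichLieb1978, eqs. (4.5), (1.51), Prop. 3.4] -/
def anisoAFKappa (n b : ℕ) (α t Δ β : ℝ) : ℝ :=
  (α * (n + t * Δ) / ((t - 1) * Δ)) ^ (((n : ℝ) ^ 2 / 4 - t * Δ * (b : ℝ) ^ 2) / (4 * n)) +
    ((n : ℝ) + 1) ^ (b ^ 2) * Real.exp (-(β * Δ * (b : ℝ) ^ 2))

/-- Unfolding lemma (definitional). [cite: FrohlichLieb1978, eqs. (4.5), (1.51)] -/
theorem anisoAFKappa_def (n b : ℕ) (α t Δ β : ℝ) :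
    anisoAFKappa n b α t Δ β =
      (α * (n + t * Δ) / ((t - 1) * Δ)) ^ (((n : ℝ) ^ 2 / 4 - t * Δ * (b : ℝ) ^ 2) / (4 * n)) +
        ((n : ℝ) + 1) ^ (b ^ 2) * Real.exp (-(β * Δ * (b : ℝ) ^ 2)) :=
  rfl

/-- `κ > 0` whenever `σ̄ ≥ 0` (e.g. `0 ≤ α`, `t > 1`, `Δ > 0`). [cite: FrohlichLieb1978, eq. (4.5)] -/
theorem anisoAFKappa_pos (n b : ℕ) {α t Δ : ℝ} (β : ℝ) (hα : 0 ≤ α) (ht : 1 < t) (hΔ : 0 < Δ) :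
    0 < anisoAFKappa n b α t Δ β := by
  rw [anisoAFKappa_def]
  have hσ : 0 ≤ α * (n + t * Δ) / ((t - 1) * Δ) :=
    div_nonneg (mul_nonneg hα (by positivity)) (mul_pos (by linarith) hΔ).le
  exact add_pos_of_nonneg_of_pos (Real.rpow_nonneg hσ _) (mul_pos (pow_pos (by positivity) _)
    (Real.exp_pos _))

/-! ### The smallness datum `Re⟨P_Λ⟩_β ≤ κ^{N²}` for the universal dipole projection -/

section Dipole

variable {N b : ℕ} [NeZero N] [NeZero b] (n : ℕ)

/-- **FL (4.5) + (1.51) for the quantum antiferromagnet: `Re⟨P_Λ⟩_β ≤ κ^{N²}`.** On the torus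
`(ℤ/Nbℤ)²` (`N > 1` even, `Nb > 2`), for `0 ≤ α`, `β ≥ 0`, `t > 1`, `Δ > 0` with `tΔb² ≤ n²/4`
((3.31)) and `σ̄ = α(n + tΔ)/((t-1)Δ) < 1` ((3.29)), for every shift `v` and every nearest-neighbour
dipole `⟨i, j⟩` of one cube of the shifted partition, the universal projection `P_Λ` obtained by
tiling `Pᵢ⁺Pⱼ⁻` over all cubes with mirror images satisfies
`Re⟨P_Λ⟩_{β, H(α)} ≤ (anisoAFKappa n b α t Δ β)^{N²}`
(`anisoAF_constrained_le` with `L = Nb`, `G = (n²/4)N²`, `Δ' = Δ(Nb)²`,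
`m = ⌊N²(n²/4 - tΔb²)/(8n)⌋ + 1`). [cite: FrohlichLieb1978, Prop. 3.4, eqs. (4.5), (1.51)] -/
theorem anisoAF_dipole_le [NeZero (N * b)] (hN : Even N) (hN1 : 1 < N) (hL : 2 < N * b)
    {α : ℝ} (hα : 0 ≤ α) {β : ℝ} (hβ : 0 ≤ β) {t Δ : ℝ} (ht : 1 < t) (hΔ : 0 < Δ)
    (hwin : t * Δ * (b : ℝ) ^ 2 ≤ (n : ℝ) ^ 2 / 4) (hσ : α * (n + t * Δ) / ((t - 1) * Δ) < 1)
    (v i j : TorusSite 2 (N * b))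
    (hij : ∃ k : Fin 2, j = i + Pi.single k 1 ∨ i = j + Pi.single k 1)
    (hblk : blockOf N b (i - v) = blockOf N b (j - v)) :
    (Matrix.gibbsState β (xyzRealFieldHamiltonian (N * b) n α (-α) 0)
      (productOp fun y => cubePattern hN v (selectedOp (szNonnegProj n) (szNegProj n) {i} {j})
        (blockOf N b (i - v)) (mirroredOffset hN y))).re ≤ anisoAFKappa n b α t Δ β ^ (N ^ 2) := by
  obtain ⟨W, hW, hPW, hWG⟩ := exists_dipolePattern_eq_diagonal n hN hN1 hL v i j hij hblk
  rw [hPW]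
  -- the parameters of `anisoAF_constrained_le`
  have hNb : Even (N * b) := hN.mul_right b
  have hb0 : (0 : ℝ) < b := by exact_mod_cast Nat.pos_of_ne_zero (NeZero.ne b)
  have hN0 : (0 : ℝ) < N := by exact_mod_cast Nat.pos_of_ne_zero (NeZero.ne N)
  have hL0 : (0 : ℝ) < ((N * b : ℕ) : ℝ) := by push_cast; positivity
  set Δ' : ℝ := Δ * ((N * b : ℕ) : ℝ) ^ 2 with hΔ'
  have hΔ'0 : 0 < Δ' := by positivity
  set G : ℝ := (n : ℝ) ^ 2 / 4 * (N : ℝ) ^ 2 with hG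
  set x : ℝ := (N : ℝ) ^ 2 * ((n : ℝ) ^ 2 / 4 - t * Δ * (b : ℝ) ^ 2) / (8 * n) with hx
  -- `n ≥ 1` (the window condition with `tΔb² > 0`)
  have hn0 : (0 : ℝ) < n := by
    have : 0 < t * Δ * (b : ℝ) ^ 2 := by positivity
    have hn2 : (0 : ℝ) < (n : ℝ) ^ 2 := by linarith
    exact_mod_cast Nat.pos_of_ne_zero fun h => by simp [h] at hn2
  have hx0 : 0 ≤ x := by rw [hx]; exact div_nonneg (mul_nonneg (by positivity) (by linarith)) (by positivity)
  set m : ℕ := ⌊x⌋₊ + 1 with hm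
  have hm1 : 1 ≤ m := Nat.le_add_left 1 _
  have hfloor : ((m - 1 : ℕ) : ℝ) ≤ x := by
    rw [hm, Nat.add_sub_cancel]
    exact Nat.floor_le hx0
  have hxm : 2 * x ≤ (2 * m : ℕ) := by
    have h := Nat.lt_floor_add_one x
    push_cast [hm]
    linarith
  -- `σ̄` at `L = Nb`, `d = 2` is the volume-independent `α(n + tΔ)/((t-1)Δ)`
  have hσeq : α * ((2 : ℕ) * n * ((N * b : ℕ) : ℝ) ^ 2 / 2 + t * Δ') / ((t - 1) * Δ') =
      α * (n + t * Δ) / ((t - 1) * Δ) := by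
    rw [hΔ']
    have hL2 : ((N * b : ℕ) : ℝ) ^ 2 ≠ 0 := by positivity
    field_simp
    push_cast
    ring
  have hσL : α * ((2 : ℕ) * n * ((N * b : ℕ) : ℝ) ^ 2 / 2 + t * Δ') / ((t - 1) * Δ') < 1 := by
    rw [hσeq]; exact hσ
  -- the step condition `(m-1)·8n + tΔ' ≤ G`
  have hmG : ((m - 1 : ℕ) : ℝ) * (4 * (2 : ℕ) * n) + t * Δ' ≤ G := by
    have h1 : ((m - 1 : ℕ) : ℝ) * (4 * (2 : ℕ) * n) ≤ x * (8 * n) := by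
      push_cast
      nlinarith [hfloor, hn0]
    have h2 : x * (8 * n) = (N : ℝ) ^ 2 * ((n : ℝ) ^ 2 / 4 - t * Δ * (b : ℝ) ^ 2) := by
      rw [hx]; field_simp
    have h3 : t * Δ' = t * Δ * (b : ℝ) ^ 2 * (N : ℝ) ^ 2 := by rw [hΔ']; push_cast; ring
    rw [h2] at h1
    rw [h3, hG]
    nlinarith [h1]
  have hmain := anisoAF_constrained_le (N * b) n hNb hα hβ hW hWG ht hΔ'0 hσL hm1 hmG
  rw [hσeq] at hmain
  refine hmain.trans ?_
  -- `σ̄^{2m} ≤ κ₁^{N²}` and the tail is `κ₂^{N²}`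
  set σb := α * (n + t * Δ) / ((t - 1) * Δ) with hσb
  have hσb0 : 0 ≤ σb := div_nonneg (mul_nonneg hα (by positivity)) (mul_pos (by linarith) hΔ).le
  set κ₁ : ℝ := σb ^ (((n : ℝ) ^ 2 / 4 - t * Δ * (b : ℝ) ^ 2) / (4 * n)) with hκ₁
  set κ₂ : ℝ := ((n : ℝ) + 1) ^ (b ^ 2) * Real.exp (-(β * Δ * (b : ℝ) ^ 2)) with hκ₂
  have hκ₁0 : 0 ≤ κ₁ := Real.rpow_nonneg hσb0 _
  have hκ₂0 : 0 ≤ κ₂ := by positivity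
  have hk : anisoAFKappa n b α t Δ β = κ₁ + κ₂ := rfl
  have h1 : σb ^ (2 * m) ≤ κ₁ ^ (N ^ 2) := by
    have hexp : κ₁ ^ (N ^ 2) = σb ^ (2 * x) := by
      rw [hκ₁, ← Real.rpow_natCast, ← Real.rpow_mul hσb0, hx]
      congr 1
      push_cast
      field_simp
      ring
    rw [hexp, ← Real.rpow_natCast]
    rcases hσb0.eq_or_lt with h0 | hpos
    · rw [← h0, Real.zero_rpow (Nat.cast_ne_zero.2 (by omega))]
      exact Real.rpow_nonneg le_rfl _
    · exact Real.rpow_le_rpow_of_exponent_ge hpos hσ.le hxm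
  have h2 : ((n : ℝ) + 1) ^ ((N * b) ^ 2) * Real.exp (-(β * Δ')) = κ₂ ^ (N ^ 2) := by
    rw [hκ₂, hΔ', show ((((n : ℝ) + 1) ^ (b ^ 2)) * Real.exp (-(β * Δ * (b : ℝ) ^ 2))) ^ (N ^ 2) =
      ((n : ℝ) + 1) ^ (b ^ 2 * N ^ 2) * Real.exp (((N ^ 2 : ℕ) : ℝ) * (-(β * Δ * (b : ℝ) ^ 2))) by
      rw [mul_pow, ← pow_mul, ← Real.exp_nat_mul]]
    congr 2
    · ring
    · push_cast; ring
  rw [hk, h2]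
  have hN2 : N ^ 2 ≠ 0 := pow_ne_zero 2 (NeZero.ne N)
  exact (add_le_add h1 le_rfl).trans (pow_add_pow_le hκ₁0 hκ₂0 hN2)

end Dipole

/-! ### Long-range order -/

section LRO

variable {N b : ℕ} [NeZero N] [NeZero b] (n : ℕ)

/-- **Volume-uniform Peierls–chessboard two-point bound for the quantum antiferromagnet
`-Σ(αS¹S¹ - αS²S² + S³S³)`** (FL model (3) in frame (1.4a)): on `(ℤ/Nbℤ)²` (`N > 1` even,
`Nb > 2`), for every spin `n/2`, every `0 ≤ α`, `β ≥ 0`, auxiliary `t > 1`, `Δ > 0` with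
`tΔb² ≤ n²/4`, `σ̄ = α(n + tΔ)/((t-1)Δ) < 1`, `κ = anisoAFKappa n b α t Δ β ≤ 1` and
`ρ = 4·19⁶·κ^{(b-1)/b⁵} < 1`: `Re⟨Pₘ⁺Pₙ⁻⟩_β ≤ 4ρ/(1-ρ)²` for all `m ≠ n`
(`P⁺ = 𝟙[S³ ≥ 0]`, `P⁻ = 𝟙[S³ < 0]`), uniformly in `N`.
[cite: FrohlichLieb1978, Thm. 1.1, Cor. 1.2, eqs. (1.44), (4.5), (1.51), Prop. 3.4] -/
theorem anisoAF_twoPoint_le [NeZero (N * b)] (hN : Even N) (hN1 : 1 < N) (hL : 2 < N * b)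
    {α : ℝ} (hα : 0 ≤ α) {β : ℝ} (hβ : 0 ≤ β) {t Δ : ℝ} (ht : 1 < t) (hΔ : 0 < Δ)
    (hwin : t * Δ * (b : ℝ) ^ 2 ≤ (n : ℝ) ^ 2 / 4) (hσ : α * (n + t * Δ) / ((t - 1) * Δ) < 1)
    (hκ1 : anisoAFKappa n b α t Δ β ≤ 1)
    (hρ : 4 * 19 ^ 6 * anisoAFKappa n b α t Δ β ^ (((b - 1 : ℕ) : ℝ) / (b : ℝ) ^ (2 * 2 + 1)) < 1)
    {m n' : TorusSite 2 (N * b)} (hmn : m ≠ n') :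
    (Matrix.gibbsState β (xyzRealFieldHamiltonian (N * b) n α (-α) 0)
        (onSite m (szNonnegProj n) * onSite n' (szNegProj n))).re ≤
      4 * (4 * 19 ^ 6 * anisoAFKappa n b α t Δ β ^ (((b - 1 : ℕ) : ℝ) / (b : ℝ) ^ (2 * 2 + 1))) /
        (1 - 4 * 19 ^ 6 * anisoAFKappa n b α t Δ β ^ (((b - 1 : ℕ) : ℝ) / (b : ℝ) ^ (2 * 2 + 1))) ^ 2 := by
  have h := xyzReal_twoPoint_le n hN hN1 hL (Real.sqrt α) (Real.sqrt α) hβ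
    (szNonnegProj_posSemidef n) (szNegProj_posSemidef n) (szNonnegProj_add_szNegProj n)
    (szNonnegProj_map_starRingEnd n) (szNegProj_map_starRingEnd n)
    (anisoAFKappa_pos n b β hα ht hΔ) hκ1
  rw [Real.sq_sqrt hα] at h
  exact h (fun v i j hij hblk => anisoAF_dipole_le n hN hN1 hL hα hβ ht hΔ hwin hσ v i j hij hblk)
    hρ hmn

/-- **Long-range order of the Ising-anisotropic quantum antiferromagnet at low temperature and
small anisotropy, uniformly in the volume** (Fröhlich–Lieb's theorem for model (3), order
observable `σ = P⁺ - P⁻ = sgn S³` in the rotated frame = the staggered sign of `Sᶻ`): on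
`(ℤ/Nbℤ)²` (`N > 1` even, `Nb > 2`), for every spin `n/2`, `0 ≤ α`, `β ≥ 0`, `t > 1`, `Δ > 0`
with `tΔb² ≤ n²/4`, `α(n + tΔ)/((t-1)Δ) < 1`, `κ = anisoAFKappa n b α t Δ β ≤ 1` and
`κ^{(b-1)/b⁵} ≤ 10⁻¹⁰`: `Re⟨σₘσₙ⟩_β ≥ 1/2` for all `m ≠ n`.
[cite: FrohlichLieb1978, §I.A (3), eqs. (1.9)–(1.24), Thm. 1.1, Cor. 1.2, Prop. 3.4, §IV (c')] -/
theorem anisoAF_sigma_twoPoint_ge_half [NeZero (N * b)] (hN : Even N) (hN1 : 1 < N)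
    (hL : 2 < N * b) {α : ℝ} (hα : 0 ≤ α) {β : ℝ} (hβ : 0 ≤ β) {t Δ : ℝ} (ht : 1 < t) (hΔ : 0 < Δ)
    (hwin : t * Δ * (b : ℝ) ^ 2 ≤ (n : ℝ) ^ 2 / 4) (hσ : α * (n + t * Δ) / ((t - 1) * Δ) < 1)
    (hκ1 : anisoAFKappa n b α t Δ β ≤ 1)
    (hθ : anisoAFKappa n b α t Δ β ^ (((b - 1 : ℕ) : ℝ) / (b : ℝ) ^ (2 * 2 + 1)) ≤ 1 / 10 ^ 10)
    {m n' : TorusSite 2 (N * b)} (hmn : m ≠ n') :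
    (1 : ℝ) / 2 ≤ (Matrix.gibbsState β (xyzRealFieldHamiltonian (N * b) n α (-α) 0)
        (onSite m (szNonnegProj n - szNegProj n) * onSite n' (szNonnegProj n - szNegProj n))).re := by
  have h := xyzReal_sigma_twoPoint_ge_half n hN hN1 hL (Real.sqrt α) (Real.sqrt α) hβ
    (szNonnegProj_posSemidef n) (szNegProj_posSemidef n) (szNonnegProj_add_szNegProj n)
    (szNonnegProj_map_starRingEnd n) (szNegProj_map_starRingEnd n)
    (anisoAFKappa_pos n b β hα ht hΔ) hκ1
  rw [Real.sq_sqrt hα] at h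
  exact h (fun v i j hij hblk => anisoAF_dipole_le n hN hN1 hL hα hβ ht hΔ hwin hσ v i j hij hblk)
    hθ hmn

end LRO

/-! ### Cubes of side `2`: explicit thresholds -/

section Explicit

variable {N : ℕ} [NeZero N] (n : ℕ)

/-- `1 < 2·10³²⁰` (kept symbolic: the numeral is above `norm_num`'s evaluation threshold).
[folklore] -/
private theorem iaf_one_lt_big : (1 : ℝ) < 2 * 10 ^ 320 := by
  have h : (1 : ℝ) ≤ 10 ^ 320 := one_le_pow₀ (by norm_num)
  exact one_lt_two.trans_le (le_mul_of_one_le_right zero_le_two h)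

/-- `1 ≤ 2·10³²⁰`. [folklore] -/
private theorem iaf_one_le_big : (1 : ℝ) ≤ 2 * 10 ^ 320 := iaf_one_lt_big.le

/-- `(2·10³²⁰)⁻¹ = 10⁻³²⁰/2`. [folklore] -/
private theorem iaf_inv_big : (2 * 10 ^ 320 : ℝ)⁻¹ = 1 / 10 ^ 320 / 2 := by
  rw [eq_comm, one_div, div_eq_mul_inv, ← mul_inv, mul_comm ((10 : ℝ) ^ 320) 2]

/-- With cubes of side `b = 2` the chain's threshold `κ^{1/32} ≤ 10⁻¹⁰` reads `κ ≤ 10⁻³²⁰`.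
[cite: FrohlichLieb1978, Thm. 1.1, Cor. 1.2] -/
private theorem iaf_threshold_two {κ : ℝ} (hκ0 : 0 < κ) (hκ : κ ≤ 1 / 10 ^ 320) :
    κ ≤ 1 ∧ κ ^ (((2 - 1 : ℕ) : ℝ) / ((2 : ℕ) : ℝ) ^ (2 * 2 + 1)) ≤ 1 / 10 ^ 10 := by
  refine ⟨hκ.trans (by rw [one_div]; exact inv_le_one_of_one_le₀ (one_le_pow₀ (by norm_num))), ?_⟩
  have hexp : (((2 - 1 : ℕ) : ℝ) / ((2 : ℕ) : ℝ) ^ (2 * 2 + 1)) = ((32 : ℕ) : ℝ)⁻¹ := by norm_num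
  rw [hexp]
  calc κ ^ (((32 : ℕ) : ℝ)⁻¹) ≤ ((1 : ℝ) / 10 ^ 320) ^ (((32 : ℕ) : ℝ)⁻¹) :=
        Real.rpow_le_rpow hκ0.le hκ (by positivity)
    _ = 1 / 10 ^ 10 := by
        rw [show (1 : ℝ) / 10 ^ 320 = (1 / 10 ^ 10) ^ 32 by rw [div_pow, one_pow, ← pow_mul],
          Real.pow_rpow_inv_natCast (by positivity) (by norm_num)]

/-- **Long-range order with cubes of side `2`, threshold form**: on `(ℤ/2Nℤ)²` (`N > 1` even), for
`0 ≤ α`, `β ≥ 0`, `t > 1`, `Δ > 0` with `4tΔ ≤ n²/4`, `α(n + tΔ)/((t-1)Δ) < 1` and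
`anisoAFKappa n 2 α t Δ β ≤ 10⁻³²⁰`: `Re⟨σₘσₙ⟩_β ≥ 1/2` for all `m ≠ n`.
[cite: FrohlichLieb1978, §I.A (3), Thm. 1.1, Cor. 1.2, Prop. 3.4, §IV (c')] -/
theorem anisoAF_sigma_twoPoint_ge_half_two [NeZero (N * 2)] (hN : Even N) (hN1 : 1 < N)
    {α : ℝ} (hα : 0 ≤ α) {β : ℝ} (hβ : 0 ≤ β) {t Δ : ℝ} (ht : 1 < t) (hΔ : 0 < Δ)
    (hwin : t * Δ * 4 ≤ (n : ℝ) ^ 2 / 4) (hσ : α * (n + t * Δ) / ((t - 1) * Δ) < 1)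
    (hκ : anisoAFKappa n 2 α t Δ β ≤ 1 / 10 ^ 320)
    {m n' : TorusSite 2 (N * 2)} (hmn : m ≠ n') :
    (1 : ℝ) / 2 ≤ (Matrix.gibbsState β (xyzRealFieldHamiltonian (N * 2) n α (-α) 0)
        (onSite m (szNonnegProj n - szNegProj n) * onSite n' (szNonnegProj n - szNegProj n))).re := by
  obtain ⟨hκ1, hθ⟩ := iaf_threshold_two (anisoAFKappa_pos n 2 β hα ht hΔ) hκ
  have h4 : ((2 : ℕ) : ℝ) ^ 2 = 4 := by norm_num
  exact anisoAF_sigma_twoPoint_ge_half n hN hN1 (by omega) hα hβ ht hΔ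
    (by rw [h4]; exact hwin) hσ hκ1 hθ hmn

/-- The tail threshold: `β ≥ 16(log(2·10³²⁰) + 4 log(n+1))/(n²c)` (`0 < c`) gives
`(n+1)⁴ e^{-βn²c/16} ≤ ½·10⁻³²⁰`. [cite: FrohlichLieb1978, eq. (1.51), Lemma 4.2] -/
private theorem iaf_tail_le {n : ℕ} (hn : (0 : ℝ) < n) {c β : ℝ} (hc : 0 < c)
    (hβ : 16 * (Real.log (2 * 10 ^ 320) + 4 * Real.log ((n : ℝ) + 1)) / ((n : ℝ) ^ 2 * c) ≤ β) :
    ((n : ℝ) + 1) ^ (2 ^ 2) * Real.exp (-(β * ((n : ℝ) ^ 2 * c / 64) * ((2 : ℕ) : ℝ) ^ 2)) ≤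
      1 / 10 ^ 320 / 2 := by
  have hn1 : (0 : ℝ) < (n : ℝ) + 1 := by linarith
  have hK : (0 : ℝ) < 2 * 10 ^ 320 := by positivity
  have hden : (0 : ℝ) < (n : ℝ) ^ 2 * c := by positivity
  have hβ' : Real.log (2 * 10 ^ 320) + 4 * Real.log ((n : ℝ) + 1) ≤ β * ((n : ℝ) ^ 2 * c) / 16 := by
    rw [div_le_iff₀ hden] at hβ
    linarith
  have hexp : Real.exp (-(β * ((n : ℝ) ^ 2 * c / 64) * ((2 : ℕ) : ℝ) ^ 2)) ≤
      Real.exp (-(Real.log (2 * 10 ^ 320) + 4 * Real.log ((n : ℝ) + 1))) := by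
    rw [Real.exp_le_exp]
    have : β * ((n : ℝ) ^ 2 * c / 64) * ((2 : ℕ) : ℝ) ^ 2 = β * ((n : ℝ) ^ 2 * c) / 16 := by
      push_cast; ring
    rw [this]
    linarith
  have hlog4 : 4 * Real.log ((n : ℝ) + 1) = Real.log (((n : ℝ) + 1) ^ 4) := by
    rw [Real.log_pow]; norm_num
  have hval : Real.exp (-(Real.log (2 * 10 ^ 320) + 4 * Real.log ((n : ℝ) + 1))) =
      (2 * 10 ^ 320)⁻¹ * (((n : ℝ) + 1) ^ 4)⁻¹ := by
    rw [neg_add, Real.exp_add, Real.exp_neg, Real.exp_log hK, Real.exp_neg, hlog4,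
      Real.exp_log (by positivity)]
  calc ((n : ℝ) + 1) ^ (2 ^ 2) * Real.exp (-(β * ((n : ℝ) ^ 2 * c / 64) * ((2 : ℕ) : ℝ) ^ 2))
      ≤ ((n : ℝ) + 1) ^ (2 ^ 2) * ((2 * 10 ^ 320)⁻¹ * (((n : ℝ) + 1) ^ 4)⁻¹) := by
        rw [← hval]; exact mul_le_mul_of_nonneg_left hexp (by positivity)
    _ = 1 / 10 ^ 320 / 2 := by
        have h4 : ((n : ℝ) + 1) ^ 4 ≠ 0 := by positivity
        rw [show (2 ^ 2 : ℕ) = 4 by norm_num, mul_comm ((2 * 10 ^ 320 : ℝ)⁻¹), ← mul_assoc,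
          mul_inv_cancel₀ h4, one_mul, iaf_inv_big]

/-- **Long-range order of the quantum antiferromagnet for EVERY spin, explicit thresholds** (FL's
`α(S) > 0`, honest constants; `t = 2`, `Δ = n²/64`, cubes of side `2`): on `(ℤ/2Nℤ)²` (`N > 1`
even), for every spin `n/2 ≥ 1/2`, every anisotropy
`0 ≤ α ≤ (n/(64 + 2n))·(2·10³²⁰)^{-32/n}` and every `β ≥ 16(log(2·10³²⁰) + 4 log(n+1))/n²`:
`Re⟨σₘσₙ⟩_β ≥ 1/2` for all `m ≠ n` (`σ = sgn S³` in the rotated frame), uniformly in `N`.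
[cite: FrohlichLieb1978, §I.A (3), Thm. 1.1, Cor. 1.2, Prop. 3.4, §IV (c')] -/
theorem anisoAF_sigma_twoPoint_ge_half_explicit [NeZero (N * 2)] (hn : 1 ≤ n) (hN : Even N)
    (hN1 : 1 < N) {α : ℝ} (hα0 : 0 ≤ α)
    (hα : α ≤ (n : ℝ) / (64 + 2 * n) * (2 * 10 ^ 320) ^ (-(32 / (n : ℝ))))
    {β : ℝ} (hβ : 16 * (Real.log (2 * 10 ^ 320) + 4 * Real.log ((n : ℝ) + 1)) / (n : ℝ) ^ 2 ≤ β)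
    {m n' : TorusSite 2 (N * 2)} (hmn : m ≠ n') :
    (1 : ℝ) / 2 ≤ (Matrix.gibbsState β (xyzRealFieldHamiltonian (N * 2) n α (-α) 0)
        (onSite m (szNonnegProj n - szNegProj n) * onSite n' (szNonnegProj n - szNegProj n))).re := by
  have hn0 : (0 : ℝ) < n := by exact_mod_cast hn
  have hK : (0 : ℝ) < 2 * 10 ^ 320 := by positivity
  have hβ0 : 0 ≤ β := by
    refine le_trans (div_nonneg (mul_nonneg (by norm_num) (add_nonneg (Real.log_nonneg iaf_one_le_big)
      (mul_nonneg (by norm_num) (Real.log_nonneg (by linarith))))) (by positivity)) hβ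
  -- parameters `t = 2`, `Δ = n²/64`
  have ht : (1 : ℝ) < 2 := by norm_num
  have hΔ : (0 : ℝ) < (n : ℝ) ^ 2 * 1 / 64 := by positivity
  have hwin : 2 * ((n : ℝ) ^ 2 * 1 / 64) * 4 ≤ (n : ℝ) ^ 2 / 4 := by nlinarith
  -- `σ̄ = α(64 + 2n)/n ≤ (2·10³²⁰)^{-32/n} < 1`
  set q : ℝ := (2 * 10 ^ 320 : ℝ) ^ (-(32 / (n : ℝ))) with hq
  have hq0 : 0 < q := Real.rpow_pos_of_pos hK _
  have hq1 : q < 1 := Real.rpow_lt_one_of_one_lt_of_neg iaf_one_lt_big (by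
    rw [neg_lt_zero]; positivity)
  have hσeq : α * (n + 2 * ((n : ℝ) ^ 2 * 1 / 64)) / ((2 - 1) * ((n : ℝ) ^ 2 * 1 / 64)) =
      α * ((64 + 2 * n) / n) := by
    field_simp
    ring
  have hσq : α * ((64 + 2 * n) / n) ≤ q := by
    have h1 : α * ((64 + 2 * n) / n) ≤ (n : ℝ) / (64 + 2 * n) * q * ((64 + 2 * n) / n) :=
      mul_le_mul_of_nonneg_right hα (by positivity)
    have h2 : (n : ℝ) / (64 + 2 * n) * q * ((64 + 2 * n) / n) = q := by
      field_simp
    linarith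
  have hσ : α * (n + 2 * ((n : ℝ) ^ 2 * 1 / 64)) / ((2 - 1) * ((n : ℝ) ^ 2 * 1 / 64)) < 1 := by
    rw [hσeq]; exact hσq.trans_lt hq1
  -- `κ ≤ 10⁻³²⁰`
  have hκ : anisoAFKappa n 2 α 2 ((n : ℝ) ^ 2 * 1 / 64) β ≤ 1 / 10 ^ 320 := by
    rw [anisoAFKappa_def, hσeq]
    have hpow : (((n : ℝ) ^ 2 / 4 - 2 * ((n : ℝ) ^ 2 * 1 / 64) * ((2 : ℕ) : ℝ) ^ 2) / (4 * n)) =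
        (n : ℝ) / 32 := by
      push_cast
      field_simp
      ring
    rw [hpow]
    have h1 : (α * ((64 + 2 * n) / n)) ^ ((n : ℝ) / 32) ≤ 1 / 10 ^ 320 / 2 := by
      calc (α * ((64 + 2 * n) / n)) ^ ((n : ℝ) / 32) ≤ q ^ ((n : ℝ) / 32) :=
            Real.rpow_le_rpow (by positivity) hσq (by positivity)
        _ = 1 / 10 ^ 320 / 2 := by
            rw [hq, ← Real.rpow_mul hK.le, show -(32 / (n : ℝ)) * ((n : ℝ) / 32) = -1 by
              field_simp, Real.rpow_neg_one, iaf_inv_big]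
    have h2 := iaf_tail_le hn0 one_pos (c := 1) (β := β) (by rwa [mul_one])
    rw [show (2 ^ 2 : ℕ) = 4 by norm_num] at h2
    exact (add_le_add h1 h2).trans_eq (add_halves _)
  exact anisoAF_sigma_twoPoint_ge_half_two n hN hN1 hα0 hβ0 ht hΔ hwin hσ hκ hmn

/-- **Fröhlich–Lieb: `α(S) → 1` as `S → ∞`** (§I.A (3): "As `S → ∞`, `α(S) → 1`"), in the tree's
honest-constant form: for every anisotropy `0 ≤ α < 1` there is a spin threshold `n₀` such that
for every spin `n/2` with `n ≥ n₀` there is `β₀` with long-range order `Re⟨σₘσₙ⟩_β ≥ 1/2` for all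
`β ≥ β₀`, all even `N > 1` and all `m ≠ n` on `(ℤ/2Nℤ)²` (`t = 2/(1-α)`, `Δ = n²(1-α)/64`:
`σ̄ = (2α/(1+α))(1 + 32/n) → 2α/(1+α) < 1` and the localization factor `σ̄^{n/32} → 0`).
[cite: FrohlichLieb1978, §I.A (3), Prop. 3.4 (Remark), §IV (c')] -/
theorem anisoAF_longRangeOrder_of_lt_one {α : ℝ} (hα0 : 0 ≤ α) (hα1 : α < 1) :
    ∃ n₀ : ℕ, ∀ n : ℕ, n₀ ≤ n → ∃ β₀ : ℝ, ∀ β : ℝ, β₀ ≤ β →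
      ∀ {N : ℕ} [NeZero N] [NeZero (N * 2)], Even N → 1 < N →
        ∀ {m n' : TorusSite 2 (N * 2)}, m ≠ n' →
          (1 : ℝ) / 2 ≤ (Matrix.gibbsState β (xyzRealFieldHamiltonian (N * 2) n α (-α) 0)
            (onSite m (szNonnegProj n - szNegProj n) * onSite n' (szNonnegProj n - szNegProj n))).re := by
  -- the limiting localization ratio `q₀ = (1+3α)/(2(1+α)) ∈ (2α/(1+α), 1)`
  set q₀ : ℝ := (1 + 3 * α) / (2 * (1 + α)) with hq₀
  have h1α : 0 < 1 + α := by linarith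
  have hq₀0 : 0 < q₀ := by positivity
  have hq₀1 : q₀ < 1 := by rw [hq₀, div_lt_one (by positivity)]; linarith
  have hlogq : Real.log q₀ < 0 := Real.log_neg hq₀0 hq₀1
  have hK : (0 : ℝ) < 2 * 10 ^ 320 := by positivity
  set K : ℝ := Real.log (2 * 10 ^ 320) with hKdef
  have hK0 : 0 ≤ K := Real.log_nonneg iaf_one_le_big
  -- the spin threshold
  obtain ⟨n₀, hn₀1, hn₀a, hn₀b⟩ : ∃ n₀ : ℕ, 1 ≤ n₀ ∧ 128 * α / (1 - α) ≤ n₀ ∧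
      32 * K / (-Real.log q₀) ≤ n₀ := by
    obtain ⟨k, hk⟩ := exists_nat_ge (max 1 (max (128 * α / (1 - α)) (32 * K / (-Real.log q₀))))
    refine ⟨k, ?_, ?_, ?_⟩
    · exact_mod_cast (le_max_left _ _).trans hk
    · exact ((le_max_left _ _).trans (le_max_right _ _)).trans hk
    · exact ((le_max_right _ _).trans (le_max_right _ _)).trans hk
  refine ⟨n₀, fun n hn => ?_⟩
  have hn1 : 1 ≤ n := hn₀1.trans hn
  have hn0 : (0 : ℝ) < n := by exact_mod_cast hn1
  have hnR : (n₀ : ℝ) ≤ n := by exact_mod_cast hn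
  -- parameters
  set t : ℝ := 2 / (1 - α) with htdef
  have h1α' : 0 < 1 - α := by linarith
  have ht : 1 < t := by rw [htdef, lt_div_iff₀ h1α']; linarith
  set Δ : ℝ := (n : ℝ) ^ 2 * (1 - α) / 64 with hΔdef
  have hΔ : 0 < Δ := by positivity
  have htΔ : t * Δ = (n : ℝ) ^ 2 / 32 := by rw [htdef, hΔdef]; field_simp; ring
  have hwin : t * Δ * 4 ≤ (n : ℝ) ^ 2 / 4 := by rw [htΔ]; nlinarith
  have ht1 : (t - 1) * Δ = (1 + α) * (n : ℝ) ^ 2 / 64 := by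
    rw [htdef, hΔdef]; field_simp; ring
  -- `σ̄ = (2α/(1+α))(1 + 32/n) ≤ q₀`
  have hσeq : α * (n + t * Δ) / ((t - 1) * Δ) = 2 * α / (1 + α) * (1 + 32 / n) := by
    rw [htΔ, ht1]; field_simp; ring
  have hσq : α * (n + t * Δ) / ((t - 1) * Δ) ≤ q₀ := by
    rw [hσeq, hq₀]
    have h128 : 128 * α ≤ (1 - α) * n := by
      rw [div_le_iff₀ h1α'] at hn₀a; nlinarith
    rw [div_mul_eq_mul_div, div_le_div_iff₀ h1α (by positivity)]
    have : 2 * α * (1 + 32 / (n : ℝ)) * (2 * (1 + α)) = (1 + α) * (4 * α + 128 * α / n) := by ring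
    rw [this]
    have h2 : 128 * α / (n : ℝ) ≤ 1 - α := by rw [div_le_iff₀ hn0]; linarith
    nlinarith
  have hσ : α * (n + t * Δ) / ((t - 1) * Δ) < 1 := hσq.trans_lt hq₀1
  -- the temperature threshold
  refine ⟨16 * (K + 4 * Real.log ((n : ℝ) + 1)) / ((n : ℝ) ^ 2 * (1 - α)), fun β hβ N _ _ hN hN1 m n' hmn => ?_⟩
  have hβ0 : 0 ≤ β := le_trans (div_nonneg (mul_nonneg (by norm_num) (add_nonneg hK0
    (mul_nonneg (by norm_num) (Real.log_nonneg (by linarith))))) (by positivity)) hβ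
  -- `κ ≤ 10⁻³²⁰`
  have hκ : anisoAFKappa n 2 α t Δ β ≤ 1 / 10 ^ 320 := by
    rw [anisoAFKappa_def]
    have hpow : (((n : ℝ) ^ 2 / 4 - t * Δ * ((2 : ℕ) : ℝ) ^ 2) / (4 * n)) = (n : ℝ) / 32 := by
      rw [show t * Δ * ((2 : ℕ) : ℝ) ^ 2 = t * Δ * 4 by norm_num, htΔ]
      field_simp
      ring
    rw [hpow]
    have hσ0 : 0 ≤ α * (n + t * Δ) / ((t - 1) * Δ) :=
      div_nonneg (mul_nonneg hα0 (by positivity)) (by rw [ht1]; positivity)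
    have h1 : (α * (n + t * Δ) / ((t - 1) * Δ)) ^ ((n : ℝ) / 32) ≤ 1 / 10 ^ 320 / 2 := by
      calc (α * (n + t * Δ) / ((t - 1) * Δ)) ^ ((n : ℝ) / 32) ≤ q₀ ^ ((n : ℝ) / 32) :=
            Real.rpow_le_rpow hσ0 hσq (by positivity)
        _ ≤ Real.exp (-K) := by
            rw [Real.rpow_def_of_pos hq₀0, Real.exp_le_exp]
            have h32 : 32 * K ≤ (n : ℝ) * (-Real.log q₀) := by
              rw [div_le_iff₀ (by linarith)] at hn₀b; nlinarith
            nlinarith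
        _ = 1 / 10 ^ 320 / 2 := by
            rw [hKdef, Real.exp_neg, Real.exp_log hK, iaf_inv_big]
    have h2 := iaf_tail_le hn0 h1α' (β := β) (by simpa only [hKdef] using hβ)
    have hΔ2 : Δ * ((2 : ℕ) : ℝ) ^ 2 = ((n : ℝ) ^ 2 * (1 - α) / 64) * ((2 : ℕ) : ℝ) ^ 2 := rfl
    have h2' : ((n : ℝ) + 1) ^ (2 ^ 2) * Real.exp (-(β * Δ * ((2 : ℕ) : ℝ) ^ 2)) ≤ 1 / 10 ^ 320 / 2 := by
      rw [mul_assoc β, hΔ2, ← mul_assoc]; exact h2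
    rw [show (2 ^ 2 : ℕ) = 4 by norm_num] at h2'
    exact (add_le_add h1 h2').trans_eq (add_halves _)
  exact anisoAF_sigma_twoPoint_ge_half_two n hN hN1 hα0 hβ0 ht hΔ hwin hσ hκ hmn

end Explicit

end Literature.MathematicalPhysics.QuantumLattice

end
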